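import Literature.Topology.FourManifolds.FieldPushforward
import Literature.Topology.FourManifolds.FlowsProofs
import Literature.Topology.FourManifolds.Isotopy
import HarnessLib

/-!
# Flows of vector fields pushed forward from a chart: ambient isotopies with prescribed tracks

Topic `Literature/Topology/FourManifolds` (trunk T-4MAN). Infrastructure for the fact seat
`provefact-Literature.Topology.FourManifolds.Knot.IsConnectedSum.isIsotopic` (Schubert's theorem:
the geometric heart `Knot.Schubert1949_normalPosition_rebuilt`, `SchubertNormalForm.lean`, is to be
proved by explicit ambient isotopies of `𝕊³` — contractions of balls, translations along a
thickened band — all of which are **flows of compactly supported vector fields given in a chart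
with full target**, e.g. the chart `PatchThickening.chart` of a thickened band,
`BandTransport.lean`). Everything here is proved; no named facts are introduced.

Let `N` be a closed manifold (compact, Hausdorff, without boundary points) modelled on the
finite-dimensional real vector space `E`, and `Φ : N ⊇ U → E` a chart with **full target**, smooth
with smooth inverse (`Literature.Topology.FourManifolds.IsFullChart`; the charts produced by
`exists_chart_of_isSmoothEmbedding`, `ChartTransport.lean`, from open smooth embeddings `E ↪ N`).
For a smooth compactly supported vector field `V : E → E`:

* `Literature.Topology.FourManifolds.chartField Φ V` — the push-forward of `V` along `Φ⁻¹`,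
  extended by zero: on `U` it is Mathlib's pull-back `VectorField.mpullback` of `V` along `Φ`
  (`= dΦ⁻¹ (V ∘ Φ)`, `chartField_symm_apply`, by the tree's `mpullback_apply_eq_mfderiv`,
  `FieldPushforward.lean`), off `U` it is `0`; it vanishes off the compact set `Φ⁻¹ (supp V)`
  (`chartField_eq_zero`) and is a **smooth vector field on `N`** (`IsFullChart.contMDiff_chartField`:
  Mathlib's `ContMDiffAt.mpullback_vectorField_preimage` on `U`, the zero section near the
  complement);
* `Literature.Topology.FourManifolds.flowIsotopy hX` — the **ambient isotopy generated by a smooth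
  vector field `X` on a closed manifold** (`Isotopy.lean`'s `AmbientIsotopy` with stages the
  time-`t` maps of the flow of `FlowsProofs.lean`, Lee (2012), Thm. 9.12 / Cor. 9.17; each stage
  is a diffeomorphism, `GlobalFlow.diffeomorph`, `Flows.lean`; zeros of the field are fixed,
  `flow_eq_self_of_eq_zero`), its speed-`c` reparametrisation `flowIsotopyAt hX c` (end stage =
  time-`c` map) and `isAmbientIsotopic_flow` (every map into `N` is ambient isotopic to its
  composite with a time map of the flow; Hirsch (1976), Ch. 8 §1, Thm. 1.2);
* **prescribed tracks** (uniqueness of integral curves, `eqOn_flow_of_isMIntegralCurveOn`, and the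
  naturality of integral curves under the local diffeomorphism `Φ⁻¹`,
  `IsMIntegralCurveOn.comp_mpullback`): if `γ` solves `γ' = V (γ)` on an open interval through
  `0`, then the flow of `chartField Φ V` carries `Φ⁻¹ (γ 0)` along `Φ⁻¹ ∘ γ`
  (`IsFullChart.flow_chartField_symm`); in particular where `V` is a constant vector `c` the flow
  is the transported translation `Φ⁻¹ (y + s c)` (`flow_chartField_symm_of_line`), and where
  `V y = -(y - o)` it is the transported homothety `Φ⁻¹ (o + e^{-s} (y - o))`
  (`flow_chartField_symm_of_homothety`); and points off `Φ⁻¹ (supp V)` do not move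
  (`IsFullChart.flow_chartField_eq_self`).

## References

* J. M. Lee, *Introduction to Smooth Manifolds*, 2nd ed., GTM 218 (2012), Prop. 8.19 (push-forward
  of vector fields), Prop. 9.6 / Cor. 9.14 (naturality of integral curves), Thm. 9.12, Thm. 9.16,
  Cor. 9.17 (flows; compactly supported fields are complete). [LeeSmoothManifolds2013]
* M. W. Hirsch, *Differential Topology*, GTM 33 (1976), Ch. 8 §1, Thms. 1.1–1.2 (vector fields
  with compact support generate diffeotopies). [HirschDT1976]
-/

open scoped Manifold ContDiff Topology
open Set Function Filter VectorField

noncomputable section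

namespace Literature.Topology.FourManifolds

/-! ## The ambient isotopy generated by a vector field on a closed manifold -/

section FlowIsotopy

variable {E : Type*} [NormedAddCommGroup E] [NormedSpace ℝ E] [CompleteSpace E]
  {H : Type*} [TopologicalSpace H] {I : ModelWithCorners ℝ E H}
  {M : Type*} [TopologicalSpace M] [ChartedSpace H M] [IsManifold I ∞ M]
  [T2Space M] [CompactSpace M] [BoundarylessManifold I M]
  {X : Π x : M, TangentSpace I x}

/-- A zero of a smooth vector field on a closed manifold is a fixed point of its flow (the
constant curve is an integral curve; uniqueness). (The same statement is
`flow_eq_self_of_apply_eq_zero` of `GradientFlowLimits.lean`, whose Morse-theoretic imports are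
not wanted here.) [cite: LeeSmoothManifolds2013, Thm. 9.12] -/
theorem flow_eq_self_of_eq_zero
    (hX : ContMDiff I I.tangent ∞ fun x => (⟨x, X x⟩ : TangentBundle I M)) {x : M} (hx : X x = 0)
    (t : ℝ) : flow hX x t = x := by
  have h := congrFun (eq_flow_of_isMIntegralCurve hX (isMIntegralCurve_const (v := X) hx)) t
  exact h.symm

/-- The group law of the flow in the form `θ (t, θ (s, p)) = θ (t + s, p)`. [cite: LeeSmoothManifolds2013, Thm. 9.12] -/
theorem flow_flow (hX : ContMDiff I I.tangent ∞ fun x => (⟨x, X x⟩ : TangentBundle I M)) (x : M)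
    (s t : ℝ) : flow hX (flow hX x s) t = flow hX x (t + s) := by
  rw [add_comm, flow_add]

/-- **The ambient isotopy generated by a smooth vector field on a closed manifold**: its stage at
time `t` is the time-`t` map of the flow (Lee (2012), Thm. 9.12 with Cor. 9.17: on a compact
manifold every smooth vector field generates a global flow by diffeomorphisms; Hirsch (1976),
Ch. 8 §1, Thm. 1.2). [cite: LeeSmoothManifolds2013, Thm. 9.12 and Cor. 9.17] -/
def flowIsotopy (hX : ContMDiff I I.tangent ∞ fun x => (⟨x, X x⟩ : TangentBundle I M)) :
    AmbientIsotopy I M where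
  toFun t x := flow hX x t
  contMDiff := contMDiff_flow hX
  bijective t := by
    refine Function.bijective_iff_has_inverse.2 ⟨fun x ↦ flow hX x (-t), fun x ↦ ?_, fun x ↦ ?_⟩
    · exact flow_neg_flow hX x t
    · change flow hX (flow hX x (-t)) t = x
      have h := flow_neg_flow hX x (-t)
      rwa [neg_neg] at h
  isLocalDiffeomorph t :=
    (GlobalFlow.diffeomorph (θ := fun p : ℝ × M => flow hX p.2 p.1) (contMDiff_flow hX)
      (fun p => flow_zero hX p) (fun t s p => flow_flow hX p s t) t).isLocalDiffeomorph
  map_zero := funext fun x => flow_zero hX x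

/-- The stages of the generated ambient isotopy are the time maps of the flow. [folklore] -/
@[simp]
theorem flowIsotopy_toFun (hX : ContMDiff I I.tangent ∞ fun x => (⟨x, X x⟩ : TangentBundle I M))
    (t : ℝ) (x : M) : (flowIsotopy hX).toFun t x = flow hX x t := rfl

/-- **The generated ambient isotopy run at speed `c`**: stage `s` is the time-`s c` map of the flow
(the ambient isotopy generated by the field `c • X`), so that its end stage `s = 1` is the
time-`c` map. [cite: HirschDT1976, Ch. 8 §1, Thm. 1.2] -/
def flowIsotopyAt (hX : ContMDiff I I.tangent ∞ fun x => (⟨x, X x⟩ : TangentBundle I M)) (c : ℝ) :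
    AmbientIsotopy I M where
  toFun s x := flow hX x (s * c)
  contMDiff := by
    have h1 : ContMDiff (𝓘(ℝ, ℝ).prod I) (𝓘(ℝ, ℝ).prod I) ∞
        fun p : ℝ × M => (p.1 * c, p.2) := fun p =>
      ((contDiff_id.mul contDiff_const).contDiffAt.comp_contMDiffAt contMDiffAt_fst).prodMk
        contMDiffAt_snd
    exact (contMDiff_flow hX).comp h1
  bijective s := (flowIsotopy hX).bijective (s * c)
  isLocalDiffeomorph s := (flowIsotopy hX).isLocalDiffeomorph (s * c)
  map_zero := by funext x; simp [flow_zero]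

/-- The stages of the speed-`c` isotopy. [folklore] -/
@[simp]
theorem flowIsotopyAt_toFun (hX : ContMDiff I I.tangent ∞ fun x => (⟨x, X x⟩ : TangentBundle I M))
    (c s : ℝ) (x : M) : (flowIsotopyAt hX c).toFun s x = flow hX x (s * c) := rfl

/-- The end stage of the speed-`c` isotopy is the time-`c` map of the flow. [folklore] -/
theorem flowIsotopyAt_toFun_one (hX : ContMDiff I I.tangent ∞ fun x => (⟨x, X x⟩ : TangentBundle I M))
    (c : ℝ) (x : M) : (flowIsotopyAt hX c).toFun 1 x = flow hX x c := by
  simp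

/-- **Ambient isotopy along a flow**: any map `f` into `M` is ambient isotopic to `θ_c ∘ f`, the
composite with the time-`c` map of the flow of a smooth vector field (Hirsch (1976), Ch. 8 §1,
Thm. 1.2: vector fields generate isotopies). [cite: HirschDT1976, Ch. 8 §1, Thm. 1.2] -/
theorem isAmbientIsotopic_flow {EM HM : Type*} [NormedAddCommGroup EM] [NormedSpace ℝ EM]
    [TopologicalSpace HM] {I₀ : ModelWithCorners ℝ EM HM} {Y : Type*}
    (hX : ContMDiff I I.tangent ∞ fun x => (⟨x, X x⟩ : TangentBundle I M)) (f : Y → M) (c : ℝ) :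
    IsAmbientIsotopic I₀ I f (fun y ↦ flow hX (f y) c) :=
  ⟨flowIsotopyAt hX c, funext fun y ↦ by simp⟩

end FlowIsotopy

/-! ## Two topological preliminaries -/

section Topological

variable {α β : Type*} [TopologicalSpace α] [TopologicalSpace β] (e : OpenPartialHomeomorph α β)

/-- `e⁻¹ ∘ e = id` near a point of the source (Mathlib's `eventually_left_inverse`, as an
eventual equality of functions). [folklore] -/
theorem OpenPartialHomeomorph.symm_comp_eventuallyEq_id {x : α} (hx : x ∈ e.source) :
    e.symm ∘ e =ᶠ[𝓝 x] id :=
  (e.eventually_left_inverse hx).mono fun _ hy ↦ hy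

/-- `e ∘ e⁻¹ = id` near a point of the target (Mathlib's `eventually_right_inverse`). [folklore] -/
theorem OpenPartialHomeomorph.comp_symm_eventuallyEq_id {y : β} (hy : y ∈ e.target) :
    e ∘ e.symm =ᶠ[𝓝 y] id :=
  (e.eventually_right_inverse hy).mono fun _ hy ↦ hy

end Topological

/-! ## Charts with full target -/

section Chart

variable {E : Type*} [NormedAddCommGroup E] [NormedSpace ℝ E]
  {N : Type*} [TopologicalSpace N] [ChartedSpace E N]

/-- A **chart with full target, smooth with smooth inverse**: `Φ : N ⊇ Φ.source → E` is onto `E`,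
`C^∞` on its source, and `Φ⁻¹ : E → N` is `C^∞` (so `Φ⁻¹` is an open smooth embedding of the whole
model space; such charts are produced from open smooth embeddings `E ↪ N` by
`exists_chart_of_isSmoothEmbedding`, `ChartTransport.lean`, e.g. `PatchThickening.chart`,
`BandTransport.lean`). [folklore] -/
structure IsFullChart (Φ : OpenPartialHomeomorph N E) : Prop where
  /-- The chart is onto the model space. -/
  target_eq : Φ.target = univ
  /-- The chart is smooth on its source. -/
  contMDiffOn : ContMDiffOn 𝓘(ℝ, E) 𝓘(ℝ, E) ∞ Φ Φ.source
  /-- The inverse of the chart is smooth. -/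
  contMDiff_symm : ContMDiff 𝓘(ℝ, E) 𝓘(ℝ, E) ∞ Φ.symm

namespace IsFullChart

variable {Φ : OpenPartialHomeomorph N E} (h : IsFullChart Φ)
include h

/-- Every point of the model space is in the target. [folklore] -/
theorem mem_target (y : E) : y ∈ Φ.target := by
  rw [h.target_eq]; exact mem_univ y

/-- `Φ⁻¹ y` lies in the source. [folklore] -/
theorem symm_mem_source (y : E) : Φ.symm y ∈ Φ.source :=
  Φ.map_target (h.mem_target y)

/-- `Φ (Φ⁻¹ y) = y` for every `y`. [folklore] -/
theorem apply_symm (y : E) : Φ (Φ.symm y) = y :=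
  Φ.right_inv (h.mem_target y)

/-- The chart is smooth at every point of its source. [folklore] -/
theorem contMDiffAt {x : N} (hx : x ∈ Φ.source) : ContMDiffAt 𝓘(ℝ, E) 𝓘(ℝ, E) ∞ Φ x :=
  (h.contMDiffOn x hx).contMDiffAt (Φ.open_source.mem_nhds hx)

/-- `Φ ∘ Φ⁻¹ = id` near every point of the model space. [folklore] -/
theorem comp_symm_eventuallyEq (y : E) : Φ ∘ Φ.symm =ᶠ[𝓝 y] id :=
  OpenPartialHomeomorph.comp_symm_eventuallyEq_id Φ (h.mem_target y)

/-- The differential of the chart is invertible on the source, with inverse the differential of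
the inverse chart. [folklore] -/
theorem isInvertible_mfderiv {x : N} (hx : x ∈ Φ.source) :
    (mfderiv 𝓘(ℝ, E) 𝓘(ℝ, E) Φ x).IsInvertible ∧
      (mfderiv 𝓘(ℝ, E) 𝓘(ℝ, E) Φ x).inverse = mfderiv 𝓘(ℝ, E) 𝓘(ℝ, E) Φ.symm (Φ x) := by
  have hn : (∞ : ℕ∞ω) ≠ 0 := by simp
  refine isInvertible_mfderiv_of_eventuallyEq ((h.contMDiffAt hx).mdifferentiableAt hn)
    (h.contMDiff_symm.mdifferentiableAt hn) (OpenPartialHomeomorph.symm_comp_eventuallyEq_id Φ hx) ?_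
  have := h.comp_symm_eventuallyEq (Φ x)
  exact this

/-- The image under `Φ⁻¹` of a compact set is compact. [folklore] -/
theorem isCompact_image_symm {K : Set E} (hK : IsCompact K) : IsCompact (Φ.symm '' K) :=
  hK.image h.contMDiff_symm.continuous

end IsFullChart

end Chart

/-! ## The push-forward of a compactly supported field along the inverse chart -/

section Field

variable {E : Type*} [NormedAddCommGroup E] [NormedSpace ℝ E]
  {N : Type*} [TopologicalSpace N] [ChartedSpace E N]

open Classical in
/-- **The push-forward of the vector field `V : E → E` along the inverse chart `Φ⁻¹`, extended by
zero**: on the source of `Φ` it is the pull-back `mpullback Φ V = (dΦ)⁻¹ (V ∘ Φ)` (Mathlib's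
`VectorField.mpullback`; this is `dΦ⁻¹ (V)` transported, Lee (2012), Prop. 8.19), elsewhere `0`.
[cite: LeeSmoothManifolds2013, Prop. 8.19] -/
def chartField (Φ : OpenPartialHomeomorph N E) (V : E → E) : Π x : N, TangentSpace 𝓘(ℝ, E) x :=
  fun x ↦ if x ∈ Φ.source then
    mpullback 𝓘(ℝ, E) 𝓘(ℝ, E) Φ (fun y : E ↦ (V y : TangentSpace 𝓘(ℝ, E) y)) x else 0

variable {Φ : OpenPartialHomeomorph N E} {V : E → E}

/-- On the source, the field is the pull-back along the chart. [folklore] -/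
theorem chartField_of_mem {x : N} (hx : x ∈ Φ.source) :
    chartField Φ V x =
      mpullback 𝓘(ℝ, E) 𝓘(ℝ, E) Φ (fun y : E ↦ (V y : TangentSpace 𝓘(ℝ, E) y)) x := by
  simp [chartField, hx]

/-- Off the source, the field vanishes. [folklore] -/
theorem chartField_of_not_mem {x : N} (hx : x ∉ Φ.source) : chartField Φ V x = 0 := by
  simp [chartField, hx]

/-- **The field at `Φ⁻¹ y` is `dΦ⁻¹_y (V y)`**: the pull-back along `Φ` is the push-forward along
`Φ⁻¹` (`mpullback_apply_eq_mfderiv`, `FieldPushforward.lean`). [cite: LeeSmoothManifolds2013, Prop. 8.19] -/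
theorem IsFullChart.chartField_symm_apply (h : IsFullChart Φ) (y : E) :
    chartField Φ V (Φ.symm y) = mfderiv 𝓘(ℝ, E) 𝓘(ℝ, E) Φ.symm y (V y) := by
  have hn : (∞ : ℕ∞ω) ≠ 0 := by simp
  rw [chartField_of_mem (h.symm_mem_source y)]
  exact mpullback_apply_eq_mfderiv (Φ := Φ.symm) (Ψ := Φ) (h.contMDiff_symm.mdifferentiableAt hn)
    ((h.contMDiffAt (h.symm_mem_source y)).mdifferentiableAt hn) (h.comp_symm_eventuallyEq y)
    (OpenPartialHomeomorph.symm_comp_eventuallyEq_id Φ (h.symm_mem_source y)) _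

/-- The field vanishes at the points not of the form `Φ⁻¹ y` with `V y ≠ 0`. [folklore] -/
theorem chartField_eq_zero {x : N} (hx : ∀ y, Φ.symm y = x → V y = 0) : chartField Φ V x = 0 := by
  by_cases hxs : x ∈ Φ.source
  · rw [chartField_of_mem hxs, mpullback_apply]
    have hV : V (Φ x) = 0 := hx (Φ x) (Φ.left_inv hxs)
    change (mfderiv 𝓘(ℝ, E) 𝓘(ℝ, E) Φ x).inverse (V (Φ x)) = 0
    rw [hV]
    exact map_zero _
  · exact chartField_of_not_mem hxs

/-- The field vanishes off `Φ⁻¹ (support V)`. [folklore] -/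
theorem chartField_eq_zero_of_not_mem_image {x : N} (hx : x ∉ Φ.symm '' support V) :
    chartField Φ V x = 0 :=
  chartField_eq_zero fun y hy ↦ by
    by_contra hV
    exact hx ⟨y, hV, hy⟩

variable [FiniteDimensional ℝ E] [IsManifold 𝓘(ℝ, E) ∞ N] [T2Space N]

/-- **The push-forward of a smooth compactly supported field is a smooth vector field on `N`.**
On the source this is Mathlib's `ContMDiffAt.mpullback_vectorField_preimage` (the chart is smooth
with invertible differential, `V` is smooth); a point off the source has the open neighbourhood
`N ∖ Φ⁻¹ (tsupport V)` (a compact, hence closed, subset of the source) on which the field is zero.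
[cite: LeeSmoothManifolds2013, Prop. 8.19] -/
theorem IsFullChart.contMDiff_chartField (h : IsFullChart Φ) (hV : ContDiff ℝ ∞ V)
    (hVc : HasCompactSupport V) :
    ContMDiff 𝓘(ℝ, E) 𝓘(ℝ, E).tangent ∞
      fun x => (⟨x, chartField Φ V x⟩ : TangentBundle 𝓘(ℝ, E) N) := by
  haveI : CompleteSpace E := FiniteDimensional.complete ℝ E
  intro x
  by_cases hx : x ∈ Φ.source
  · -- on the source: the pull-back of a smooth field along a smooth map with invertible differential
    have hVm : ContMDiffAt 𝓘(ℝ, E) 𝓘(ℝ, E).tangent ∞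
        (fun y : E ↦ (⟨y, (V y : TangentSpace 𝓘(ℝ, E) y)⟩ : TangentBundle 𝓘(ℝ, E) E)) (Φ x) :=
      contMDiffAt_vectorSpace_iff_contDiffAt.2 hV.contDiffAt
    have key := ContMDiffAt.mpullback_vectorField_preimage (n := ∞) hVm (h.contMDiffAt hx)
      (h.isInvertible_mfderiv hx).1 (by simp)
    refine key.congr_of_eventuallyEq ?_
    filter_upwards [Φ.open_source.mem_nhds hx] with y hy
    rw [chartField_of_mem hy]
  · -- off the source: the field is zero near `x`
    have hK : IsClosed (Φ.symm '' tsupport V) := (h.isCompact_image_symm hVc).isClosed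
    have hxK : x ∉ Φ.symm '' tsupport V := by
      rintro ⟨y, -, rfl⟩
      exact hx (h.symm_mem_source y)
    have hzero : ∀ y ∉ Φ.symm '' tsupport V, chartField Φ V y = 0 := fun y hy ↦
      chartField_eq_zero_of_not_mem_image fun hy' ↦ hy (image_mono subset_closure hy')
    refine ((Bundle.contMDiff_zeroSection ℝ (TangentSpace 𝓘(ℝ, E) : N → Type _)) x).congr_of_eventuallyEq ?_
    filter_upwards [hK.isOpen_compl.mem_nhds hxK] with y hy
    simp only [Bundle.zeroSection, hzero y hy]

end Field

/-! ## The flow of the pushed-forward field: prescribed tracks -/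

section Flow

variable {E : Type*} [NormedAddCommGroup E] [NormedSpace ℝ E] [FiniteDimensional ℝ E]
  {N : Type*} [TopologicalSpace N] [ChartedSpace E N] [IsManifold 𝓘(ℝ, E) ∞ N]
  [T2Space N] [CompactSpace N] [BoundarylessManifold 𝓘(ℝ, E) N]
  {Φ : OpenPartialHomeomorph N E} {V : E → E}

/-- Local instance: a finite-dimensional model space is complete (needed by the flow). [folklore] -/
private theorem completeSpace_of_finiteDimensional : CompleteSpace E := FiniteDimensional.complete ℝ E

attribute [local instance] completeSpace_of_finiteDimensional

namespace IsFullChart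

/-- **The flow of the pushed-forward field has the transported solutions of `y' = V (y)` as
tracks**: if `γ' = V ∘ γ` on an open interval `(a, b) ∋ 0`, then the flow of `chartField Φ V`
carries `Φ⁻¹ (γ 0)` to `Φ⁻¹ (γ s)` at every time `s ∈ (a, b)` (naturality of integral curves
under the local diffeomorphism `Φ⁻¹`, `IsMIntegralCurveOn.comp_mpullback`, and uniqueness,
`eqOn_flow_of_isMIntegralCurveOn`). [cite: LeeSmoothManifolds2013, Prop. 9.6 and Thm. 9.12 (a)] -/
theorem flow_chartField_symm (h : IsFullChart Φ) (hV : ContDiff ℝ ∞ V) (hVc : HasCompactSupport V)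
    {γ : ℝ → E} {a b : ℝ} (h0 : (0 : ℝ) ∈ Ioo a b)
    (hγ : ∀ s ∈ Ioo a b, HasDerivAt γ (V (γ s)) s) {s : ℝ} (hs : s ∈ Ioo a b) :
    flow (h.contMDiff_chartField hV hVc) (Φ.symm (γ 0)) s = Φ.symm (γ s) := by
  have hn : (∞ : ℕ∞ω) ≠ 0 := by simp
  -- `γ` as an integral curve of the field `V` on the manifold `E`
  have hγ' : IsMIntegralCurveOn (I := 𝓘(ℝ, E)) γ (fun y : E ↦ (V y : TangentSpace 𝓘(ℝ, E) y))
      (Ioo a b) := by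
    intro t ht
    have h1 : HasMFDerivAt 𝓘(ℝ, ℝ) 𝓘(ℝ, E) γ t ((1 : ℝ →L[ℝ] ℝ).smulRight (V (γ t))) :=
      hasMFDerivAt_iff_hasFDerivAt.2 (hγ t ht).hasFDerivAt
    exact h1.hasMFDerivWithinAt
  -- push it to `N` along `Φ⁻¹`
  have hcurve : IsMIntegralCurveOn (Φ.symm ∘ γ)
      (mpullback 𝓘(ℝ, E) 𝓘(ℝ, E) Φ (fun y : E ↦ (V y : TangentSpace 𝓘(ℝ, E) y))) (Ioo a b) :=
    IsMIntegralCurveOn.comp_mpullback hγ' (fun t _ ↦ h.contMDiff_symm.mdifferentiableAt hn)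
      (fun t _ ↦ (h.contMDiffAt (h.symm_mem_source (γ t))).mdifferentiableAt hn)
      (fun t _ ↦ h.comp_symm_eventuallyEq (γ t))
      (fun t _ ↦ OpenPartialHomeomorph.symm_comp_eventuallyEq_id Φ (h.symm_mem_source (γ t)))
  have hcurve' : IsMIntegralCurveOn (Φ.symm ∘ γ) (chartField Φ V) (Ioo a b) := by
    intro t ht
    have h2 : chartField Φ V ((Φ.symm ∘ γ) t) =
        mpullback 𝓘(ℝ, E) 𝓘(ℝ, E) Φ (fun y : E ↦ (V y : TangentSpace 𝓘(ℝ, E) y))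
          ((Φ.symm ∘ γ) t) :=
      chartField_of_mem (h.symm_mem_source (γ t))
    rw [h2]
    exact hcurve t ht
  have key := eqOn_flow_of_isMIntegralCurveOn (h.contMDiff_chartField hV hVc) h0 hcurve' hs
  simpa only [comp_apply] using key.symm

/-- **Transported translations**: where `V` is the constant vector `c` along the segment
`y + σ c`, `σ ∈ (a, b) ∋ 0`, the flow of `chartField Φ V` is `Φ⁻¹ (y + s c)` on `Φ⁻¹ y`.
[cite: LeeSmoothManifolds2013, Thm. 9.12 (a)] -/
theorem flow_chartField_symm_of_line (h : IsFullChart Φ) (hV : ContDiff ℝ ∞ V)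
    (hVc : HasCompactSupport V) {y c : E} {a b : ℝ} (h0 : (0 : ℝ) ∈ Ioo a b)
    (hline : ∀ σ ∈ Ioo a b, V (y + σ • c) = c) {s : ℝ} (hs : s ∈ Ioo a b) :
    flow (h.contMDiff_chartField hV hVc) (Φ.symm y) s = Φ.symm (y + s • c) := by
  have hγ : ∀ σ ∈ Ioo a b, HasDerivAt (fun σ : ℝ ↦ y + σ • c) (V (y + σ • c)) σ := by
    intro σ hσ
    rw [hline σ hσ]
    simpa using ((hasDerivAt_id σ).smul_const c).const_add y
  simpa using h.flow_chartField_symm hV hVc h0 hγ hs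

/-- **Transported homotheties**: where `V y' = -(y' - o)` along the ray segment
`o + e^{-σ} (y - o)`, `σ ∈ (a, b) ∋ 0`, the flow of `chartField Φ V` is the transported contraction
`Φ⁻¹ (o + e^{-s} (y - o))` on `Φ⁻¹ y`. [cite: LeeSmoothManifolds2013, Thm. 9.12 (a)] -/
theorem flow_chartField_symm_of_homothety (h : IsFullChart Φ) (hV : ContDiff ℝ ∞ V)
    (hVc : HasCompactSupport V) {y o : E} {a b : ℝ} (h0 : (0 : ℝ) ∈ Ioo a b)
    (hrad : ∀ σ ∈ Ioo a b, V (o + Real.exp (-σ) • (y - o)) = -(Real.exp (-σ) • (y - o))) {s : ℝ}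
    (hs : s ∈ Ioo a b) :
    flow (h.contMDiff_chartField hV hVc) (Φ.symm y) s = Φ.symm (o + Real.exp (-s) • (y - o)) := by
  have hγ : ∀ σ ∈ Ioo a b, HasDerivAt (fun σ : ℝ ↦ o + Real.exp (-σ) • (y - o))
      (V (o + Real.exp (-σ) • (y - o))) σ := by
    intro σ hσ
    rw [hrad σ hσ]
    have h1 : HasDerivAt (fun σ : ℝ ↦ Real.exp (-σ)) (-Real.exp (-σ)) σ := by
      simpa using ((hasDerivAt_neg σ).exp)
    have h2 := (h1.smul_const (y - o)).const_add o
    simpa [neg_smul] using h2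
  have := h.flow_chartField_symm hV hVc h0 hγ hs
  simpa using this

/-- **Points off `Φ⁻¹ (support V)` do not move** under the flow of `chartField Φ V` (zeros of the
field are fixed points). [folklore] -/
theorem flow_chartField_eq_self (h : IsFullChart Φ) (hV : ContDiff ℝ ∞ V)
    (hVc : HasCompactSupport V) {x : N} (hx : x ∉ Φ.symm '' support V) (t : ℝ) :
    flow (h.contMDiff_chartField hV hVc) x t = x :=
  flow_eq_self_of_eq_zero _ (chartField_eq_zero_of_not_mem_image hx) t

/-- In particular points off the source of the chart do not move. [folklore] -/
theorem flow_chartField_eq_self_of_not_mem_source (h : IsFullChart Φ) (hV : ContDiff ℝ ∞ V)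
    (hVc : HasCompactSupport V) {x : N} (hx : x ∉ Φ.source) (t : ℝ) :
    flow (h.contMDiff_chartField hV hVc) x t = x :=
  h.flow_chartField_eq_self hV hVc (fun ⟨y, _, hy⟩ ↦ hx (hy ▸ h.symm_mem_source y)) t

/-- Points `Φ⁻¹ y` with `y` outside the support of `V` do not move. [folklore] -/
theorem flow_chartField_symm_eq_self (h : IsFullChart Φ) (hV : ContDiff ℝ ∞ V)
    (hVc : HasCompactSupport V) {y : E} (hy : ∀ y', Φ.symm y' = Φ.symm y → V y' = 0) (t : ℝ) :
    flow (h.contMDiff_chartField hV hVc) (Φ.symm y) t = Φ.symm y :=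
  flow_eq_self_of_eq_zero _ (chartField_eq_zero hy) t

end IsFullChart

end Flow

end Literature.Topology.FourManifolds
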